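import Literature.AlgebraicGeometry.AbelianVarieties.PoincareSheafOfPrincipal
import Literature.AlgebraicGeometry.Motives.AbelianVarietyTheoremOfCube
import Literature.AlgebraicGeometry.Modules.EquivariantStructure
import Literature.AlgebraicGeometry.Modules.EquivariantStructureRestrict
import Literature.AlgebraicGeometry.Modules.RankOneEndomorphismScalar
import Literature.AlgebraicGeometry.Morphisms.GlobalSectionsProperWithSection
import HarnessLib

/-!
# The canonical `K(Θ)`-linearisation of Mumford's bundle `Λ(𝒪(Θ))` on `A × A`

Layer `Literature/AlgebraicGeometry/AbelianVarieties`, namespace `Literature.AlgebraicGeometry.AbelianVarieties` (continuing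
★ `AbelianVarieties/PoincareSheafOfPrincipal` §1: `mumfordCocycle`, `mumfordSheaf`). THEOREMS plus four plumbing `def`s with
bodies (two `RelativeSpec.ActionOver`s, the slice morphism, a scaled isomorphism; no `Prop` is asserted); no named fact, no
instance, no notation. Cell `hodgecm-mathlib` (D-0151), M1PRIME-DAG rung 0, J0a junction (B-p07 lineage, leaf (J0a-2)):
the DESCENT DATUM of Mumford's bundle along `1 × φ_Θ : A × A → A × Â` — input `φ`/`hunit`/`hcocycle` of
★ `RelativeSpec/EquivariantModuleDescent.ActionOver.exists_descent_of_free` (J0a-3 then reads off the Poincaré sheaf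
`𝒫` on `A × Â` with `(1 × φ_Θ)^*𝒫 ≅ Λ(Θ)`). Banked capital; HC_CM is proved only modulo the 7 printed citations until
rung 0 closes.

Source: [MumfordAV1970] §8 (pp. 78–80; char `0` construction of `X̂ = X/K(L)` and of the Poincaré bundle): the action of
`K(L)` on the second factor of `X × X` lifts to `Λ(L) = m^*L ⊗ p₁^*L⁻¹ ⊗ p₂^*L⁻¹`, the lift being pinned down by the
normalisation `Λ(L)|_{{0} × X}` trivial; [MilneAV2008] I §8 (p. 40). The proof here is the rigidity argument: every
`(1 × t_P)^*Λ ≅ Λ` exists for `P ∈ K(Θ)` (theorem of the square + cubical structure, ★ `pullback_mk_mumfordCocycle`), is unique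
up to `Kˣ` (`Modules/RankOneEndomorphismScalar`, `Γ(A × A, 𝒪) = K`), and restriction to the stable slice `ι = (0, id)`
(`Modules/EquivariantStructureRestrict`), where `Λ|_{{0}×A} ≅ 𝒪` carries the trivial linearisation, fixes the scalar; unit and
cocycle conditions then hold because their two sides restrict to the same morphism.

* §1 `translationAction A χ` (`g ↦ t_{χ g}` on `A`), `secondTranslationAction A χ` (`g ↦ 1 × t_{χ g}` on `A × A`, over `p₁`),
  `sliceZero A B = (0, id) : B → A × B` and its equivariance `sliceZero_equivariant`;
* §2 `nonempty_pullback_whiskerLeft_translation_mumfordSheaf_iso` — `(1 × t_P)^*Λ(Θ) ≅ Λ(Θ)` for `P ∈ K(Θ)`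
  (`Lam_comp_translation_right_of_mem_KTheta`: `Λ(x, y ≫ t_P) = Λ(x, y)`);
* §3 `nonempty_pullback_sliceZero_mumfordSheaf_iso` — `Λ(Θ)|_{{0}×A} ≅ r'^*𝒪_{Y'}` for any `r' : A → Y'`;
* §4 **`exists_equivariantStructure_of_restrictAlong`** — RIGID DESCENT (generic): a linearisation of the restriction of a
  line bundle along an equivariant `K`-morphism between `K`-schemes with `Γ = K` lifts to a linearisation of the bundle,
  provided each `σ_g^*E ≅ E` exists;
* §5 **`exists_equivariantStructure_mumfordSheaf_of_autHom_eq`** — the `G`-linearisation of `Λ(Θ)` for ANY actions `ρ`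
  (`g ↦ 1 × t_{χ g}` on `A × A`) and `τ` (`g ↦ t_{χ g}` on `A`) over any bases, `χ : G → K(Θ)`, with the slice
  trivialisation intertwining `Φ.restrict` with the canonical linearisation of `r'^*𝒪_{Y'}` (the form consumed by ★ (T2)
  `descent_unique_of_free`); `exists_equivariantStructure_mumfordSheaf` (canonical actions);
  `nonempty_equivariantStructure_mumfordSheaf`.

## References

* [MumfordAV1970] D. Mumford, *Abelian Varieties* (1970), §8 pp. 78–80.
* [MilneAV2008] J. S. Milne, *Abelian Varieties* (v2.00, 2008), I §8 (p. 40).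
* [GortzWedhorn2023] U. Görtz, T. Wedhorn, *Algebraic Geometry II* (2023), Def./Rem. 27.1 (p. 799) (translations).
* [Hartshorne1977] R. Hartshorne, *Algebraic Geometry* (1977), I Thm. 3.4 (a) (p. 18) (`Γ = K`).
-/

noncomputable section

open CategoryTheory AlgebraicGeometry MonoidalCategory CartesianMonoidalCategory Opposite
open Literature.AlgebraicGeometry.Motives Literature.AlgebraicGeometry.Modules
open Literature.AlgebraicGeometry.RelativeSpec
open scoped MonObj

universe u

namespace Literature.AlgebraicGeometry.AbelianVarieties

variable {K : Type u} [Field K] (A : AbelianVariety K) {G : Type u} [Group G] (χ : G →* A.Points K)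

/-! ### §1 Translation actions -/

/-- **The translation action** of `G` on the scheme `A` through a homomorphism `χ : G → A(K)`:
`g ↦ t_{χ(g)}`, an action over the structure morphism `A → Spec K`
(`RelativeSpec.ActionOver`). Plumbing with body. [cite: MumfordAV1970, §8 (pp. 78–80)] -/
def translationAction : ActionOver A.X.hom G where
  aut :=
    { toFun := fun g => (Over.forget _).mapIso (A.translationIso (χ g))
      map_one' := by
        ext : 1
        change (A.translation (χ 1)).left = 𝟙 A.X.left
        rw [map_one, A.translation_one]; rfl
      map_mul' := fun g h => by
        ext : 1
        change (A.translation (χ (g * h))).left = (A.translation (χ h)).left ≫ (A.translation (χ g)).left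
        rw [map_mul, ← Over.comp_left, A.translation_comp] }
  aut_comp g := Over.w (A.translation (χ g))

/-- The automorphism by which `g` acts is the translation `t_{χ(g)}`. [cite: MumfordAV1970, §8 (pp. 78–80)] -/
@[simp]
theorem translationAction_autHom (g : G) : (translationAction A χ).autHom g = (A.translation (χ g)).left := rfl

/-- **The translation action on the second factor of `A × A`**: `g ↦ 1 × t_{χ(g)}`, an action over the first
projection `A × A → A`. Plumbing with body. [cite: MumfordAV1970, §8 (pp. 78–80)] -/
def secondTranslationAction : ActionOver (fst A.X A.X).left G where
  aut :=
    { toFun := fun g => (Over.forget _).mapIso (whiskerLeftIso A.X (A.translationIso (χ g)))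
      map_one' := by
        ext : 1
        change (A.X ◁ A.translation (χ 1)).left = 𝟙 (A.X ⊗ A.X).left
        rw [map_one, A.translation_one, MonoidalCategory.whiskerLeft_id]; rfl
      map_mul' := fun g h => by
        ext : 1
        change (A.X ◁ A.translation (χ (g * h))).left =
          (A.X ◁ A.translation (χ h)).left ≫ (A.X ◁ A.translation (χ g)).left
        rw [map_mul, ← Over.comp_left, ← MonoidalCategory.whiskerLeft_comp, A.translation_comp] }
  aut_comp g := by
    change (A.X ◁ A.translation (χ g)).left ≫ (fst A.X A.X).left = (fst A.X A.X).left
    rw [← Over.comp_left, whiskerLeft_fst]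

/-- The automorphism by which `g` acts on `A × A` is `1 × t_{χ(g)}`. [cite: MumfordAV1970, §8 (pp. 78–80)] -/
@[simp]
theorem secondTranslationAction_autHom (g : G) :
    (secondTranslationAction A χ).autHom g = (A.X ◁ A.translation (χ g)).left := rfl

/-- **The slice `ι = (0, id) : B → A × B`, `y ↦ (0, y)`** (`0` the unit of the group of `B`-valued points of `A`).
Plumbing. [cite: MumfordAV1970, §8 (pp. 78–80)] -/
def sliceZero (B : AbelianVariety K) : B.X ⟶ A.X ⊗ B.X :=
  lift (1 : B.X ⟶ A.X) (𝟙 B.X)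

/-- `ι ≫ p₁ = 0` (the unit of the group of `B`-valued points of `A`). [cite: MumfordAV1970, §8 (pp. 78–80)] -/
@[reassoc (attr := simp)]
theorem sliceZero_fst (B : AbelianVariety K) : sliceZero A B ≫ fst A.X B.X = 1 := lift_fst _ _

/-- `ι ≫ p₂ = 𝟙`. [cite: MumfordAV1970, §8 (pp. 78–80)] -/
@[reassoc (attr := simp)]
theorem sliceZero_snd (B : AbelianVariety K) : sliceZero A B ≫ snd A.X B.X = 𝟙 B.X := lift_snd _ _

/-- **The slice is equivariant**: `t_P ≫ ι = ι ≫ (1 × t_P)`. [cite: MumfordAV1970, §8 (pp. 78–80)] -/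
theorem translation_comp_sliceZero (P : A.Points K) :
    A.translation P ≫ sliceZero A A = sliceZero A A ≫ A.X ◁ A.translation P := by
  refine CartesianMonoidalCategory.hom_ext _ _ ?_ ?_
  · rw [Category.assoc, sliceZero_fst, Category.assoc, whiskerLeft_fst, sliceZero_fst, MonObj.comp_one]
  · rw [Category.assoc, sliceZero_snd, Category.assoc, whiskerLeft_snd, sliceZero_snd_assoc, Category.comp_id]

/-- The slice is equivariant for the translation actions (on schemes). [cite: MumfordAV1970, §8 (pp. 78–80)] -/
theorem sliceZero_equivariant (g : G) :
    (translationAction A χ).autHom g ≫ (sliceZero A A).left =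
      (sliceZero A A).left ≫ (secondTranslationAction A χ).autHom g := by
  rw [translationAction_autHom, secondTranslationAction_autHom, ← Over.comp_left, ← Over.comp_left,
    translation_comp_sliceZero]

/-- The slice is equivariant for ANY pair of actions acting by `t_{χ g}` on `A` and by `1 × t_{χ g}` on `A × A`
(e.g. actions presented over other bases, such as over the isogenies `φ_Θ` and `1 × φ_Θ`).
[cite: MumfordAV1970, §8 (pp. 78–80)] -/
theorem sliceZero_equivariant_of_autHom_eq {Y Y' : Scheme.{u}} {r : (A.X ⊗ A.X).left ⟶ Y} {r' : A.X.left ⟶ Y'}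
    (ρ : ActionOver r G) (τ : ActionOver r' G) (hρ : ∀ g : G, ρ.autHom g = (A.X ◁ A.translation (χ g)).left)
    (hτ : ∀ g : G, τ.autHom g = (A.translation (χ g)).left) (g : G) :
    τ.autHom g ≫ (sliceZero A A).left = (sliceZero A A).left ≫ ρ.autHom g := by
  rw [hρ, hτ, ← Over.comp_left, ← Over.comp_left, translation_comp_sliceZero]

/-! ### §2 `(1 × t_P)^* Λ(Θ) ≅ Λ(Θ)` for `P ∈ K(Θ)` (class computation: theorem of the square + cube) -/

section Existence

variable (Θ : CartierDivisor A.X.left)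

/-- `y ≫ t_P = P_T · y` on `T`-valued points (`P_T = T → Spec K →P A` the constant point). [cite: GortzWedhorn2023, Def./Rem. 27.1 (p. 799)] -/
theorem comp_translation_eq_mul {T : SchemeOver K} (y : T ⟶ A.X) (P : A.Points K) :
    y ≫ A.translation P = (toSpecOver T ≫ P) * y := by
  unfold AbelianVariety.translation
  rw [MonObj.comp_mul, Category.comp_id, ← Category.assoc]
  congr 2
  apply Over.OverMorphism.ext
  change (y.left ≫ A.X.hom) = T.hom
  exact Over.w y

/-- **`Λ(x, y ≫ t_P) = Λ(x, y)` for `P ∈ K(Θ)`**: translating the second argument by a point of `K(Θ)` does not change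
Mumford's pairing (`y ≫ t_P = P_T · y`, biadditivity of `Λ` from the cubical structure, and `Λ(P_T, x) = x^*[t_P^*Θ − Θ] = 0`
by the definition of `K(Θ)`). [cite: MumfordAV1970, §8 (pp. 78–80)] -/
theorem Lam_comp_translation_right_of_mem_KTheta {T : SchemeOver K} [IsIntegral T.left] (x y : T ⟶ A.X)
    {P : A.Points K} (hP : P ∈ A.KTheta Θ) :
    AbelianVariety.Lam Θ (cechCl T.left) x (y ≫ A.translation P) = AbelianVariety.Lam Θ (cechCl T.left) x y := by
  have hΛ : AbelianVariety.Lam Θ (cechCl T.left) x (toSpecOver T ≫ P) = 0 := by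
    rw [AbelianVariety.Lam_comm, ← ofMul_toMul (AbelianVariety.Lam Θ (cechCl T.left) _ _),
      toMul_Lam_toSpecOver_comp, (CartierDivisor.cechClass_eq_iff_linEquiv _ _).2 ((A.mem_KTheta_iff' Θ P).1 hP),
      mul_inv_cancel, MonoidHom.map_one, ofMul_one]
  rw [comp_translation_eq_mul, AbelianVariety.Lam_mul_right (cechCl_add T.left) (linEquiv_iff_cechCl_eq T.left)
    A.cubicalStructure_linEquiv_holds, hΛ, zero_add]

/-- **`(1 × t_P)^*[Λ(Θ)] = [Λ(Θ)]` in `Ȟ¹(A × A, 𝒪^×)` for `P ∈ K(Θ)`.** [cite: MumfordAV1970, §8 (pp. 78–80)] -/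
theorem pullback_whiskerLeft_translation_mk_mumfordCocycle {P : A.Points K} (hP : P ∈ A.KTheta Θ) :
    CechPic.pullback (A.X ◁ A.translation P).left (CechPic.mk (mumfordCocycle A Θ)) =
      CechPic.mk (mumfordCocycle A Θ) := by
  apply Additive.ofMul.injective
  have h₁ := pullback_mk_mumfordCocycle A Θ (𝟙 (A.X ⊗ A.X))
  rw [Category.id_comp, Category.id_comp, Over.id_left, CechPic.pullback_id_apply] at h₁
  rw [pullback_mk_mumfordCocycle, whiskerLeft_fst, whiskerLeft_snd, Lam_comp_translation_right_of_mem_KTheta A Θ _ _ hP,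
    h₁]

/-- **`(1 × t_P)^* Λ(Θ) ≅ Λ(Θ)` as `𝒪`-modules, for `P ∈ K(Θ)`** (existence only; the normalised choice is §4).
[cite: MumfordAV1970, §8 (pp. 78–80)] -/
theorem nonempty_pullback_whiskerLeft_translation_mumfordSheaf_iso {P : A.Points K} (hP : P ∈ A.KTheta Θ) :
    Nonempty ((Scheme.Modules.pullback (A.X ◁ A.translation P).left).obj (mumfordSheaf A Θ) ≅ mumfordSheaf A Θ) := by
  refine (nonempty_iso_iff_detClass_eq (hasRank_pullback _ (hasRank_mumfordSheaf A Θ)) (hasRank_mumfordSheaf A Θ)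
    ((isFiniteLocallyFree_mumfordSheaf A Θ).pullback _) (isFiniteLocallyFree_mumfordSheaf A Θ)).2 ?_
  rw [detClass_pullback _ (isFiniteLocallyFree_mumfordSheaf A Θ)]
  exact (congrArg _ (mumfordCocycle A Θ).detClass_lineBundle).trans
    ((pullback_whiskerLeft_translation_mk_mumfordCocycle A Θ hP).trans (mumfordCocycle A Θ).detClass_lineBundle.symm)

end Existence

/-! ### §3 The slice `Λ(Θ)|_{{0} × A}` is trivial -/

section Slice

variable (Θ : CartierDivisor A.X.left)

/-- **`Λ(Θ)|_{{0} × A} ≅ r'^* 𝒪`** — the restriction of Mumford's bundle along the slice `ι = (0, id)` is the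
trivial line bundle, written as the inverse image of the structure sheaf along ANY morphism `r' : A → Y'` (so that it carries
the canonical trivial linearisation `EquivariantStructure.ofPullback` of an action over `r'`). (`Λ(1, y) = 0`,
★ `pullback_mk_mumfordCocycle_of_fst_eq_one`.) [cite: MumfordAV1970, §8 (Λ(L)|_{{0}×X} is trivial)] [cite: MilneAV2008, I §8 (p. 40)] -/
theorem nonempty_pullback_sliceZero_mumfordSheaf_iso {Y' : Scheme.{u}} (r' : A.X.left ⟶ Y') :
    Nonempty ((Scheme.Modules.pullback (sliceZero A A).left).obj (mumfordSheaf A Θ) ≅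
      (Scheme.Modules.pullback r').obj (unitModule Y')) := by
  have hO : IsFiniteLocallyFree (unitModule Y') := HasRank.isFiniteLocallyFree' hasRank_unitModule
  refine (nonempty_iso_iff_detClass_eq (hasRank_pullback _ (hasRank_mumfordSheaf A Θ))
    (hasRank_pullback _ hasRank_unitModule) ((isFiniteLocallyFree_mumfordSheaf A Θ).pullback _) (hO.pullback _)).2 ?_
  rw [detClass_pullback _ (isFiniteLocallyFree_mumfordSheaf A Θ), detClass_pullback _ hO, detClass_unitModule_eq_one,
    MonoidHom.map_one]
  exact (congrArg _ (mumfordCocycle A Θ).detClass_lineBundle).trans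
    (pullback_mk_mumfordCocycle_of_fst_eq_one A Θ (sliceZero A A) (sliceZero_fst A A))

/-- `(1 × t_P)^* Λ(Θ)` has rank one. [cite: MilneAV2008, I §8 (p. 40)] -/
theorem hasRank_pullback_mumfordSheaf {Y : Scheme.{u}} (f : Y ⟶ (A.X ⊗ A.X).left) :
    HasRank ((Scheme.Modules.pullback f).obj (mumfordSheaf A Θ)) 1 :=
  hasRank_pullback _ (hasRank_mumfordSheaf A Θ)

end Slice

/-! ### §4 Rigid descent of a linearisation from an equivariant slice -/

section RigidDescent

variable {XY SY : Over (Spec (CommRingCat.of K))}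

/-- Scaling an isomorphism of modules on a `K`-scheme by a unit of `K`. Plumbing. [cite: MumfordAV1970, §8 (pp. 78–80)] -/
def unitSmulIso {M N : XY.left.Modules} (u : Kˣ) (e : M ≅ N) : M ≅ N where
  hom := (u : K) • e.hom
  inv := (u⁻¹ : Kˣ).val • e.inv
  hom_inv_id := by
    rw [Linear.smul_comp, Linear.comp_smul, smul_smul, e.hom_inv_id, Units.mul_inv, one_smul]
  inv_hom_id := by
    rw [Linear.smul_comp, Linear.comp_smul, smul_smul, e.inv_hom_id, Units.inv_mul, one_smul]

/-- Unfolding `unitSmulIso`. [cite: MumfordAV1970, §8 (pp. 78–80)] -/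
@[simp]
theorem unitSmulIso_hom {M N : XY.left.Modules} (u : Kˣ) (e : M ≅ N) : (unitSmulIso u e).hom = (u : K) • e.hom := rfl

/-- `Γ(Y, 𝒪_Y) = K` for an integral `K`-scheme, universally closed over `K`, with a `K`-point (★
`Morphisms.bijective_algebraMapΓ_of_universallyClosed_of_section`, in the `scalarRingHomTop` spelling of `Modules/LinearOverBase`).
[cite: Hartshorne1977, I Thm. 3.4 (a) (p. 18)] -/
theorem bijective_scalarRingHomTop_of_point (Y : SchemeOver K) [IsIntegral Y.left] [UniversallyClosed Y.hom]
    (P : AlgPoints Y K) : Function.Bijective (scalarRingHomTop Y) := by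
  have hP : P.left ≫ Y.hom = 𝟙 _ := by
    rw [Over.w P]
    simp only [specOver, Over.mk_hom, Algebra.algebraMap_self, CommRingCat.ofHom_id, Spec.map_id]
    rfl
  exact Morphisms.bijective_algebraMapΓ_of_universallyClosed_of_section Y.hom P.left hP

/-- **Rigid descent of a linearisation from an equivariant slice.** Let `ρ` act on `X`, `τ` on `S`, `j : S ⟶ X` a
`K`-morphism with `τ_g ≫ j = j ≫ σ_g`, `E` a line bundle on `X` with `σ_g^* E ≅ E` for all `g`, and suppose `Γ(X, 𝒪) = K =
Γ(S, 𝒪)`. Then every `G`-linearisation `Ψ` of `j^* E` for `τ` LIFTS UNIQUELY-UP-TO-NOTHING: there is a `G`-linearisation `Φ`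
of `E` for `ρ` whose restriction along `j` is `Ψ` on the nose. (Existence of each `Φ_g` with prescribed restriction: rescale
any isomorphism by the unit scalar read off on `S`; unit and cocycle conditions: both sides are isomorphisms `σ^* E ≅ E`,
hence differ by a scalar (`Modules/RankOneEndomorphismScalar`), which is `1` because their restrictions along `j` agree
(`Modules/EquivariantStructureRestrict`).) This is Mumford's normalisation argument for `Λ(L)` along `{0} × X`.
[cite: MumfordAV1970, §8 (pp. 78–80)] -/
theorem exists_equivariantStructure_of_restrictAlong {Y Y' : Scheme.{u}} {r : XY.left ⟶ Y} {r' : SY.left ⟶ Y'}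
    (ρ : ActionOver r G) (τ : ActionOver r' G) (j : SY ⟶ XY) (hι : ∀ g : G, τ.autHom g ≫ j.left = j.left ≫ ρ.autHom g)
    {E : XY.left.Modules} (hE : IsFiniteLocallyFree E) (h₁ : HasRank E 1)
    (hΓX : Function.Bijective (scalarRingHomTop XY)) (hΓS : Function.Bijective (scalarRingHomTop SY))
    (hT : ∀ g : G, Nonempty ((Scheme.Modules.pullback (ρ.autHom g)).obj E ≅ E))
    (Ψ : τ.EquivariantStructure ((Scheme.Modules.pullback j.left).obj E)) :
    ∃ Φ : ρ.EquivariantStructure E, ∀ g : G, restrictAlong ρ τ j.left hι E g (Φ.iso g).hom = (Ψ.iso g).hom := by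
  -- notation and rank bookkeeping
  have h₁τ : ∀ g : G, HasRank ((Scheme.Modules.pullback (τ.autHom g)).obj ((Scheme.Modules.pullback j.left).obj E)) 1 :=
    fun g => hasRank_pullback _ (hasRank_pullback _ h₁)
  have h₁σ : ∀ g : G, HasRank ((Scheme.Modules.pullback (ρ.autHom g)).obj E) 1 := fun g => hasRank_pullback _ h₁
  have hR : ∀ (g : G) (c : K) (ψ : (Scheme.Modules.pullback (ρ.autHom g)).obj E ⟶ E),
      restrictAlong ρ τ j.left hι E g (c • ψ) = c • restrictAlong ρ τ j.left hι E g ψ := by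
    intro g c ψ
    rw [restrictAlong, restrictAlong, pullback_map_base_smul, Linear.comp_smul]
  -- uniqueness of the scalar `1` on `S`: `θ = c • θ` for an isomorphism `θ` forces `c = 1`
  have hone : ∀ (g : G) (θ : (Scheme.Modules.pullback (τ.autHom g)).obj ((Scheme.Modules.pullback j.left).obj E) ≅
      (Scheme.Modules.pullback j.left).obj E) (c : K), θ.hom = c • θ.hom → c = 1 := by
    intro g θ c hc
    obtain ⟨c₀, -, huniq⟩ := exists_unique_iso_hom_eq_smul hΓS (h₁τ g) θ θ
    rw [huniq c hc, huniq 1 (one_smul K θ.hom).symm]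
  -- step 1: each `σ_g^* E ≅ E`, rescaled so that its restriction is `Ψ_g`
  have step : ∀ g : G, ∃ φ : (Scheme.Modules.pullback (ρ.autHom g)).obj E ≅ E,
      restrictAlong ρ τ j.left hι E g φ.hom = (Ψ.iso g).hom := by
    intro g
    obtain ⟨ψ⟩ := hT g
    obtain ⟨d, hd, -⟩ := exists_unique_iso_hom_eq_smul hΓS (h₁τ g) (restrictAlongIso τ j.left hι g ψ) (Ψ.iso g)
    have hdu : IsUnit d := isUnit_of_iso_hom_eq_smul hΓS (h₁τ g) (restrictAlongIso τ j.left hι g ψ) (Ψ.iso g) hd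
    refine ⟨unitSmulIso hdu.unit ψ, ?_⟩
    rw [unitSmulIso_hom, IsUnit.unit_spec, hR, ← restrictAlongIso_hom, ← hd]
  choose φ hφ using step
  refine ⟨{ iso := φ, iso_one := ?_, iso_mul := fun g h => ?_ }, hφ⟩
  · -- unit condition: `φ_1` and the canonical isomorphism differ by a scalar whose restriction is `1`
    obtain ⟨c, hc, -⟩ := exists_unique_iso_hom_eq_smul hΓX (h₁σ 1) (φ 1) (ρ.pullbackOneIso E)
    have hc1 : c = 1 := by
      refine hone 1 (τ.pullbackOneIso _) c ?_
      have h := congrArg (restrictAlong ρ τ j.left hι E 1) hc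
      rw [restrictAlong_pullbackOneIso ρ τ j.left hι hE, hR, hφ, Ψ.iso_one] at h
      exact h
    rw [hc1, one_smul] at hc
    exact Iso.ext hc.symm
  · -- cocycle condition: same argument with `restrictAlong_mul`
    obtain ⟨c, hc, -⟩ := exists_unique_iso_hom_eq_smul hΓX (h₁σ (g * h)) (φ (g * h))
      (ρ.pullbackMulIso g h E ≪≫ (Scheme.Modules.pullback (ρ.autHom h)).mapIso (φ g) ≪≫ φ h)
    have hc1 : c = 1 := by
      refine hone (g * h) (Ψ.iso (g * h)) c ?_
      have h' := congrArg (restrictAlong ρ τ j.left hι E (g * h)) hc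
      simp only [Iso.trans_hom, Functor.mapIso_hom] at h'
      rw [restrictAlong_mul ρ τ j.left hι hE, hR, hφ, hφ, hφ] at h'
      have hm : (τ.pullbackMulIso g h _).hom ≫ (Scheme.Modules.pullback (τ.autHom h)).map (Ψ.iso g).hom ≫
          (Ψ.iso h).hom = (Ψ.iso (g * h)).hom := by
        rw [Ψ.iso_mul]; rfl
      rw [hm] at h'
      exact h'
    rw [hc1, one_smul] at hc
    exact Iso.ext hc.symm

end RigidDescent

/-! ### §5 The canonical `K(Θ)`-linearisation of `Λ(𝒪(Θ))` -/

section Linearisation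

variable (Θ : CartierDivisor A.X.left)

/-- **Mumford's `K(Θ)`-linearisation of `Λ(𝒪(Θ))`, normalised along `{0} × A` — for any presentation of the actions.**
Let `G` act on `A × A` by `ρ`, `g ↦ 1 × t_{χ g}`, and on `A` by `τ`, `g ↦ t_{χ g}` (as `ActionOver`s over ANY bases
`r : A × A → Y`, `r' : A → Y'`; e.g. B-p16's `kThetaActionOver` over `1 × φ_Θ` and `kThetaBaseActionOver` over `φ_Θ`), with
`χ` valued in `K(Θ)`. Then Mumford's bundle `Λ(Θ)` carries a `G`-linearisation `Φ` for `ρ` (`Modules/EquivariantStructure`,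
the descent datum consumed by `RelativeSpec/EquivariantModuleDescent`), together with a trivialisation
`e : Λ(Θ)|_{{0}×A} ≅ r'^*𝒪_{Y'}` of the slice which INTERTWINES the restriction of `Φ` along `ι = (0, id)` with the
canonical (trivial) linearisation of `r'^*𝒪_{Y'}` («the action of `K(L)` on the second factor lifts to `Λ(L)`», normalised
by «`Λ(L)|_{{0}×X}` trivial»). [cite: MumfordAV1970, §8 (pp. 78–80)] [cite: MilneAV2008, I §8 (p. 40)] -/
theorem exists_equivariantStructure_mumfordSheaf_of_autHom_eq {Y Y' : Scheme.{u}} {r : (A.X ⊗ A.X).left ⟶ Y}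
    {r' : A.X.left ⟶ Y'} (ρ : ActionOver r G) (τ : ActionOver r' G)
    (hρ : ∀ g : G, ρ.autHom g = (A.X ◁ A.translation (χ g)).left) (hτ : ∀ g : G, τ.autHom g = (A.translation (χ g)).left)
    (hχ : ∀ g : G, χ g ∈ A.KTheta Θ) :
    ∃ (e : (Scheme.Modules.pullback (sliceZero A A).left).obj (mumfordSheaf A Θ) ≅
        (Scheme.Modules.pullback r').obj (unitModule Y'))
      (Φ : ρ.EquivariantStructure (mumfordSheaf A Θ)),
      ∀ g : G, restrictAlong ρ τ (sliceZero A A).left (sliceZero_equivariant_of_autHom_eq A χ ρ τ hρ hτ)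
          (mumfordSheaf A Θ) g (Φ.iso g).hom ≫ e.hom =
        (Scheme.Modules.pullback (τ.autHom g)).map e.hom ≫
          ((ActionOver.EquivariantStructure.ofPullback τ (unitModule Y')).iso g).hom := by
  obtain ⟨e⟩ := nonempty_pullback_sliceZero_mumfordSheaf_iso A Θ r'
  have hT : ∀ g : G, Nonempty ((Scheme.Modules.pullback (ρ.autHom g)).obj (mumfordSheaf A Θ) ≅ mumfordSheaf A Θ) := by
    intro g
    rw [hρ g]
    exact nonempty_pullback_whiskerLeft_translation_mumfordSheaf_iso A Θ (hχ g)
  obtain ⟨Φ, hΦ⟩ := exists_equivariantStructure_of_restrictAlong ρ τ (sliceZero A A)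
    (sliceZero_equivariant_of_autHom_eq A χ ρ τ hρ hτ) (isFiniteLocallyFree_mumfordSheaf A Θ) (hasRank_mumfordSheaf A Θ)
    (bijective_scalarRingHomTop_of_point (A.X ⊗ A.X) ((1 : A.Points K) ≫ sliceZero A A))
    (bijective_scalarRingHomTop_of_point A.X (1 : A.Points K)) hT
    ((ActionOver.EquivariantStructure.ofPullback τ (unitModule Y')).ofIso e.symm)
  refine ⟨e, Φ, fun g => ?_⟩
  rw [hΦ g]
  simp only [ActionOver.EquivariantStructure.ofIso, Iso.trans_hom, Functor.mapIso_hom, Iso.symm_symm_eq, Iso.symm_hom,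
    Category.assoc, Iso.inv_hom_id, Category.comp_id]

/-- **Mumford's `K(Θ)`-linearisation of `Λ(𝒪(Θ))` for the canonical actions** `secondTranslationAction` /
`translationAction` (over `p₁ : A × A → A` and `A → Spec K`), normalised along `{0} × A` against `r^*𝒪_{Spec K}`.
[cite: MumfordAV1970, §8 (pp. 78–80)] [cite: MilneAV2008, I §8 (p. 40)] -/
theorem exists_equivariantStructure_mumfordSheaf (hχ : ∀ g : G, χ g ∈ A.KTheta Θ) :
    ∃ (e : (Scheme.Modules.pullback (sliceZero A A).left).obj (mumfordSheaf A Θ) ≅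
        (Scheme.Modules.pullback A.X.hom).obj (unitModule (Spec (CommRingCat.of K))))
      (Φ : (secondTranslationAction A χ).EquivariantStructure (mumfordSheaf A Θ)),
      ∀ g : G, restrictAlong (secondTranslationAction A χ) (translationAction A χ) (sliceZero A A).left
          (sliceZero_equivariant_of_autHom_eq A χ _ _ (secondTranslationAction_autHom A χ) (translationAction_autHom A χ))
          (mumfordSheaf A Θ) g (Φ.iso g).hom ≫ e.hom =
        (Scheme.Modules.pullback ((translationAction A χ).autHom g)).map e.hom ≫
          ((ActionOver.EquivariantStructure.ofPullback (translationAction A χ)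
            (unitModule (Spec (CommRingCat.of K)))).iso g).hom :=
  exists_equivariantStructure_mumfordSheaf_of_autHom_eq A χ Θ _ _ (secondTranslationAction_autHom A χ)
    (translationAction_autHom A χ) hχ

/-- **Corollary (the bare descent datum)**: `Λ(Θ)` carries SOME `G`-linearisation for any action `ρ` on `A × A` by
`1 × t_{χ g}`, `χ : G → K(Θ)` — the hypotheses `φ`/`hunit`/`hcocycle` of ★ `ActionOver.exists_descent_of_free` are
`Φ.iso`, `Φ.iso_one_hom`, `Φ.iso_mul_hom`. [cite: MumfordAV1970, §8 (pp. 78–80)] -/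
theorem nonempty_equivariantStructure_mumfordSheaf {Y : Scheme.{u}} {r : (A.X ⊗ A.X).left ⟶ Y} (ρ : ActionOver r G)
    (hρ : ∀ g : G, ρ.autHom g = (A.X ◁ A.translation (χ g)).left) (hχ : ∀ g : G, χ g ∈ A.KTheta Θ) :
    Nonempty (ρ.EquivariantStructure (mumfordSheaf A Θ)) := by
  obtain ⟨-, Φ, -⟩ := exists_equivariantStructure_mumfordSheaf_of_autHom_eq A χ Θ ρ (translationAction A χ) hρ
    (translationAction_autHom A χ) hχ
  exact ⟨Φ⟩

end Linearisation

end Literature.AlgebraicGeometry.AbelianVarieties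

end
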